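import Summits.Parity.BatemanHorn.Theses.RoughParitySectors
import Summits.Parity.BatemanHorn.Theorems.BalancedSemiprimeLayer.Negative.FalseWithoutIrreducible

/-!
# `OddSectorShareNonlinear` (crux stmt-Parity-15628): `irreducible` is load-bearing

Negative-side load-bearing analysis of the crux
`Summit.Parity.BatemanHorn.Theses.RoughParitySectors.OddSectorShareNonlinear`, PROVED.  The crux
quantifies over Bateman–Horn systems `f` (`IsBatemanHornSystem f`: irreducible, positive leading
coefficients, pairwise non-associated, no fixed prime divisor) with some member of degree `≥ 2` and
asserts `|c₁(x,U)·(U·e^{−γ}/2)^k − c_odd(x,U)| ≤ η·c_odd(x,U)` for `U ≥ U₀(η)`, eventually in `x`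
(conclusion copied VERBATIM below), where `c₁` counts the jointly rough `n ≤ x` with every `fᵢ(n)`
prime (`Ω = 1`) and `c_odd` those with every `Ω(fᵢ(n))` odd.

* `oddSectorShareNonlinear_false_without_irreducible`: with `irreducible` DROPPED (the other three
  fields and the degree hypothesis kept) the statement is FALSE.  Witness the system `(X³)`
  (positive leading coefficient, trivially pairwise non-associated, no fixed prime divisor
  `hasNoFixedPrimeDivisor_X_pow_three`, degree `3 ≥ 2`): `Ω(n³) = 3·Ω(n)`, so the prime cell
  `{Ω = 1}` is EMPTY, while the all-odd sector `{Ω(n³) odd} = {Ω(n) odd}` contains every prime `q`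
  with `x^{3/U} ≤ q ≤ x` — for `U ≥ 6` and `x ≥ 4` Bertrand's postulate provides one in `(x/2, x]`
  (and `x^{3/U} ≤ √x ≤ x/2`).  Hence `|c₁·A − c_odd| = c_odd > c_odd/2` at EVERY large `x`
  (`η = 1/2`).
* Note that `(X²)` would NOT be a witness here (contrary to the sibling cruxes `RoughParityBalance`,
  `BalancedSemiprimeLayer`): `Ω(n²)` is even, so BOTH cells are empty and the inequality `0 ≤ 0`
  holds.  Irreducibility is load-bearing through forced ODD multiplicity (`n ↦ n³` keeps the parity
  of `Ω` but destroys primality).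
-/

namespace Summit.Parity.BatemanHorn.Theorems.OddSectorShareNonlinear.Negative

open Filter Finset Polynomial Real
open scoped Topology
open Literature.NumberTheory.Sieve
open Summit.Parity.BatemanHorn.Theorems.BalancedSemiprimeLayer.Negative (card_filter_range_dvd)

/-- `#{n < p : p ∣ n³} = 1` for a prime `p`. [folklore] -/
theorem card_filter_range_dvd_pow_three {p : ℕ} (hp : p.Prime) :
    #((range p).filter (fun n : ℕ => (p : ℤ) ∣ (n : ℤ) ^ 3)) = 1 := by
  have h : ∀ n : ℕ, ((p : ℤ) ∣ (n : ℤ) ^ 3) ↔ p ∣ n := by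
    intro n
    rw [← Nat.cast_pow, Int.natCast_dvd_natCast]
    exact ⟨fun h => hp.dvd_of_dvd_pow h, fun h => dvd_pow h three_ne_zero⟩
  simp_rw [h]
  exact card_filter_range_dvd hp

/-- `(X³)` has no fixed prime divisor (`ω(p) = 1`). [folklore] -/
theorem hasNoFixedPrimeDivisor_X_pow_three : HasNoFixedPrimeDivisor ![(X ^ 3 : ℤ[X])] := by
  intro p hp
  unfold polyRootCountMod
  simp only [Fin.prod_univ_one, Matrix.cons_val_fin_one, eval_pow, eval_X]
  rw [card_filter_range_dvd_pow_three hp]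
  exact hp.one_lt

/-- **Any proof of `OddSectorShareNonlinear` must use `irreducible`**: with that field of
`IsBatemanHornSystem` dropped (the other three and the degree hypothesis kept, conclusion verbatim)
the statement is false (witness `(X³)`, `η = 1/2`: the prime cell of the rough values of a cube is
empty, the all-odd sector contains the primes in `(x/2, x]`). [folklore] -/
theorem oddSectorShareNonlinear_false_without_irreducible :
    ¬ ∀ (k : ℕ) (f : Fin k → ℤ[X]), (∀ i, 0 < (f i).leadingCoeff) →
      (Pairwise fun i j => ¬Associated (f i) (f j)) → HasNoFixedPrimeDivisor f →
        (∃ i, 2 ≤ (f i).natDegree) → ∀ η : ℝ, 0 < η → ∃ U₀ : ℝ, ∀ U : ℝ, U₀ ≤ U → ∀ᶠ x : ℕ in atTop,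
          |(((((Icc 1 x).filter (fun n : ℕ => ∀ i, 0 < (f i).eval (n : ℤ) ∧
              ∀ p ∈ range ⌈(x : ℝ) ^ (((f i).natDegree : ℝ) / U)⌉₊, p.Prime →
                ¬ ((p : ℤ) ∣ (f i).eval (n : ℤ)))).filter (fun n : ℕ => ∀ i,
              ArithmeticFunction.cardFactors (((f i).eval (n : ℤ)).toNat) = 1)).card : ℕ) : ℝ) *
              (U * Real.exp (-Real.eulerMascheroniConstant) / 2) ^ k -
            (((((Icc 1 x).filter (fun n : ℕ => ∀ i, 0 < (f i).eval (n : ℤ) ∧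
              ∀ p ∈ range ⌈(x : ℝ) ^ (((f i).natDegree : ℝ) / U)⌉₊, p.Prime →
                ¬ ((p : ℤ) ∣ (f i).eval (n : ℤ)))).filter (fun n : ℕ => ∀ i,
              Odd (ArithmeticFunction.cardFactors (((f i).eval (n : ℤ)).toNat)))).card : ℕ) : ℝ)| ≤
            η * (((((Icc 1 x).filter (fun n : ℕ => ∀ i, 0 < (f i).eval (n : ℤ) ∧
              ∀ p ∈ range ⌈(x : ℝ) ^ (((f i).natDegree : ℝ) / U)⌉₊, p.Prime →
                ¬ ((p : ℤ) ∣ (f i).eval (n : ℤ)))).filter (fun n : ℕ => ∀ i,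
              Odd (ArithmeticFunction.cardFactors (((f i).eval (n : ℤ)).toNat)))).card : ℕ) :
                ℝ) := by
  intro h
  have hlc : ∀ i, 0 < (![(X ^ 3 : ℤ[X])] i).leadingCoeff := by
    intro i; fin_cases i; simp
  have hdeg : ∃ i, 2 ≤ (![(X ^ 3 : ℤ[X])] i).natDegree :=
    ⟨0, by rw [Matrix.cons_val_zero, natDegree_X_pow]; norm_num⟩
  obtain ⟨U₀, hU⟩ := h 1 ![X ^ 3] hlc Subsingleton.pairwise hasNoFixedPrimeDivisor_X_pow_three hdeg
    (1 / 2) one_half_pos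
  obtain ⟨U, hU₀U, hU6⟩ : ∃ U : ℝ, U₀ ≤ U ∧ 6 ≤ U := ⟨max U₀ 6, le_max_left _ _, le_max_right _ _⟩
  obtain ⟨x, hx4, hx⟩ := ((eventually_ge_atTop 4).and (hU U hU₀U)).exists
  -- the prime cell of the rough values of `X³` is empty: `Ω(n³) = 3 Ω(n) ≠ 1`
  have hprime : ((Icc 1 x).filter (fun n : ℕ => ∀ i : Fin 1,
      0 < (![(X ^ 3 : ℤ[X])] i).eval (n : ℤ) ∧
      ∀ p ∈ range ⌈(x : ℝ) ^ (((![(X ^ 3 : ℤ[X])] i).natDegree : ℝ) / U)⌉₊, p.Prime →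
        ¬ ((p : ℤ) ∣ (![(X ^ 3 : ℤ[X])] i).eval (n : ℤ)))).filter (fun n : ℕ => ∀ i : Fin 1,
          ArithmeticFunction.cardFactors (((![(X ^ 3 : ℤ[X])] i).eval (n : ℤ)).toNat) = 1) = ∅ := by
    refine filter_false_of_mem fun n _ hn => ?_
    have h0 := hn 0
    rw [Matrix.cons_val_zero, eval_pow, eval_X, ← Nat.cast_pow, Int.toNat_natCast,
      ArithmeticFunction.cardFactors_pow] at h0
    omega
  -- Bertrand: a prime `q ∈ (x/2, x]`; it lies in the all-odd sector: `Ω(q³) = 3` is odd and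
  -- `q > x/2 ≥ √x ≥ x^{3/U}` is above the sifting threshold
  obtain ⟨q, hq, hxq, hqx⟩ := Nat.exists_prime_lt_and_le_two_mul (x / 2) (by omega)
  have hqx' : q ≤ x := by omega
  have h2q : (x : ℝ) < 2 * q := by exact_mod_cast (show x < 2 * q by omega)
  have hx1 : (1 : ℝ) ≤ x := by exact_mod_cast (show 1 ≤ x by omega)
  have hx4' : (4 : ℝ) ≤ x := by exact_mod_cast hx4
  have h3U : ((3 : ℕ) : ℝ) / U ≤ 1 / 2 := by
    rw [div_le_iff₀ (by linarith), Nat.cast_ofNat]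
    linarith
  have h2s : (2 : ℝ) ≤ √(x : ℝ) := (Real.le_sqrt' two_pos).2 (by rw [sq]; linarith)
  have hsx : √(x : ℝ) ≤ x / 2 := by
    nlinarith [Real.mul_self_sqrt ((Nat.cast_nonneg x : (0 : ℝ) ≤ x)), Real.sqrt_nonneg (x : ℝ),
      mul_nonneg (sub_nonneg.2 h2s) (Real.sqrt_nonneg (x : ℝ))]
  have hqR : q ∈ ((Icc 1 x).filter (fun n : ℕ => ∀ i : Fin 1,
      0 < (![(X ^ 3 : ℤ[X])] i).eval (n : ℤ) ∧
      ∀ p ∈ range ⌈(x : ℝ) ^ (((![(X ^ 3 : ℤ[X])] i).natDegree : ℝ) / U)⌉₊, p.Prime →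
        ¬ ((p : ℤ) ∣ (![(X ^ 3 : ℤ[X])] i).eval (n : ℤ)))).filter (fun n : ℕ => ∀ i : Fin 1,
          Odd (ArithmeticFunction.cardFactors (((![(X ^ 3 : ℤ[X])] i).eval (n : ℤ)).toNat))) := by
    rw [mem_filter, mem_filter, mem_Icc]
    refine ⟨⟨⟨hq.one_lt.le, hqx'⟩, Fin.forall_fin_one.2 ⟨?_, fun p hp hpp hdvd => ?_⟩⟩,
      Fin.forall_fin_one.2 ?_⟩
    · rw [Matrix.cons_val_zero, eval_pow, eval_X]
      exact pow_pos (Int.natCast_pos.2 hq.pos) 3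
    · rw [Matrix.cons_val_zero, eval_pow, eval_X, ← Nat.cast_pow, Int.natCast_dvd_natCast] at hdvd
      rw [Matrix.cons_val_zero, natDegree_X_pow, mem_range, Nat.lt_ceil] at hp
      have hpq : p = q := (Nat.prime_dvd_prime_iff_eq hpp hq).1 (hpp.dvd_of_dvd_pow hdvd)
      rw [hpq] at hp
      have h1 : (x : ℝ) ^ (((3 : ℕ) : ℝ) / U) ≤ (x : ℝ) ^ (1 / (2 : ℝ)) :=
        Real.rpow_le_rpow_of_exponent_le hx1 h3U
      rw [← Real.sqrt_eq_rpow] at h1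
      linarith
    · rw [Matrix.cons_val_zero, eval_pow, eval_X, ← Nat.cast_pow, Int.toNat_natCast,
        ArithmeticFunction.cardFactors_pow, ArithmeticFunction.cardFactors_apply_prime hq]
      decide
  have hpos : (0 : ℝ) < (((((Icc 1 x).filter (fun n : ℕ => ∀ i : Fin 1,
      0 < (![(X ^ 3 : ℤ[X])] i).eval (n : ℤ) ∧
      ∀ p ∈ range ⌈(x : ℝ) ^ (((![(X ^ 3 : ℤ[X])] i).natDegree : ℝ) / U)⌉₊, p.Prime →
        ¬ ((p : ℤ) ∣ (![(X ^ 3 : ℤ[X])] i).eval (n : ℤ)))).filter (fun n : ℕ => ∀ i : Fin 1,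
          Odd (ArithmeticFunction.cardFactors (((![(X ^ 3 : ℤ[X])] i).eval (n : ℤ)).toNat)))).card :
            ℕ) : ℝ) := by
    exact_mod_cast card_pos.2 ⟨q, hqR⟩
  rw [hprime, card_empty, Nat.cast_zero, zero_mul, zero_sub, abs_neg, abs_of_pos hpos] at hx
  linarith

end Summit.Parity.BatemanHorn.Theorems.OddSectorShareNonlinear.Negative
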